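import Literature.Computability.QuantumComplexity.ApproxStabilizerRankTypicalProofs
import HarnessLib

/-!
# A sign state of large approximate stabilizer rank (Mehraban–Tahmasbi 2024, Lemma 3.2 — witness exposed)

Mehraban, Tahmasbi, *Quadratic lower bounds on the approximate stabilizer rank: a probabilistic
approach*, STOC 2024 (arXiv:2305.10277), §3.1 **Lemma 3.2** (existence of an `n`-qubit state with
`δ`-approximate stabilizer rank `Ω((1−δ²)² 2ⁿ/n²)`; there via Haar measure + Lévy concentration).
The tree's discharge `MehrabanTahmasbi2024_exists_large_approxRank_holds`
(`ApproxStabilizerRankTypicalProofs.lean`) runs the probabilistic method over the `2^{2ⁿ}` SIGN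
STATES `φ_s = 2^{-n/2} Σ_x (−1)^{s(x)} |x⟩` and therefore proves MORE than the fact it closes
(`∃ φ, ‖φ‖ = 1 ∧ …`): the witness is a sign state.  This file records that stronger, witnessed
form as a theorem of its own,

* `MehrabanTahmasbi2024_exists_large_approxRank_signVec :
    ∃ C ≥ 1/1000, ∀ δ ∈ (0,1), ∀ n ≥ 2 log₂(1/(1−δ²)) + 9, ∃ s : {0,1}ⁿ → {0,1},
      C (1−δ²)² 2ⁿ/n² ≤ χ_δ(φ_s)`,

with the SAME proof (steps 1–3 of the `_holds` docstring: Dehaene–De Moor parameter count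
`exists_param_comb_of_stabilizerRank_le`, Hoeffding mass bound + grid `card_signVec_close_span_le`,
union bound `key_inequality`), the only change being that the final `refine` keeps `s` instead of
packaging `signVec s` with `sum_norm_sq_signVec`.  Purpose: the synthesis route to the quadratic
bound `χ_δ(|T⟩^{⊗m}) = Ω̃(m²)` (the tree's FACT `MehrabanTahmasbi2024_approxRank_magicT_quadratic`)
prepares the witness EXACTLY from `T` gates — a sign state is the phase-kickback image of the
reversible Boolean oracle of `s` — and needs the witness named, not hidden behind `∃ φ`.
`MehrabanTahmasbi2024_exists_large_approxRank_holds` is the 3-line corollary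
`⟨signVec s, sum_norm_sq_signVec s, hs⟩` of this theorem (not restated here: it is landed).
No new definitions, no named facts.

## References
* [MehrabanTahmasbi2024] S. Mehraban, M. Tahmasbi, STOC 2024, arXiv:2305.10277, §3.1 Lemma 3.2
  (with Lemma 3.4, Lemma 2.2, Thm 2.3 / Lemma 2.4).
-/

noncomputable section

namespace Literature.Computability.QuantumComplexity

open _root_.Computability Cryptography Matrix Finset

open ApproxRankTypical in
/-- **Mehraban–Tahmasbi, Lemma 3.2 with the witness exposed: a SIGN STATE of large approximate
stabilizer rank.**  For every `δ ∈ (0,1)` and `n ≥ 2 log₂(1/(1−δ²)) + 9` some sign state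
`φ_s = 2^{-n/2} Σ_x (−1)^{s(x)} |x⟩`, `s : {0,1}ⁿ → {0,1}`, has `χ_δ(φ_s) ≥ (1/1000)(1−δ²)² 2ⁿ/n²`.
Proof = the probabilistic method over sign states exactly as in
`MehrabanTahmasbi2024_exists_large_approxRank_holds` (count the low-rank directions by the
Dehaene–De Moor normal form, bound the number of sign states near one span by Hoeffding + a grid,
union bound), keeping the witness.
[cite: MehrabanTahmasbi2024, Lemma 3.2 (arXiv:2305.10277 §3.1 pp. 12–13, with Lemma 3.4, Lemma 2.2, Thm. 2.3)] -/
theorem MehrabanTahmasbi2024_exists_large_approxRank_signVec :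
    ∃ C : ℝ, 1 / 1000 ≤ C ∧ ∀ (δ : ℝ), 0 < δ → δ < 1 → ∀ n : ℕ,
      2 * Real.logb 2 (1 / (1 - δ ^ 2)) + 9 ≤ (n : ℝ) →
        ∃ s : QReg n → Bool,
          C * (1 - δ ^ 2) ^ 2 * (2 : ℝ) ^ n / (n : ℝ) ^ 2 ≤ (approxStabilizerRank δ (signVec s) : ℝ) := by
  classical
  refine ⟨1 / 1000, le_rfl, fun δ hδ0 hδ1 n hn => ?_⟩
  set g := 1 - δ ^ 2 with hg
  have hg0 : 0 < g := by nlinarith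
  have hg1 : g ≤ 1 := by nlinarith
  set R₀ : ℝ := 1 / 1000 * g ^ 2 * 2 ^ n / (n : ℝ) ^ 2 with hR₀
  have hR₀0 : 0 ≤ R₀ := by positivity
  set r : ℕ := ⌈R₀⌉₊ - 1 with hr
  have hrR : (r : ℝ) ≤ R₀ := by
    have := Nat.ceil_lt_add_one hR₀0
    rw [hr]
    rcases Nat.eq_zero_or_pos ⌈R₀⌉₊ with h0 | hpos
    · rw [h0]; simpa using hR₀0
    · rw [Nat.cast_sub hpos, Nat.cast_one]; linarith
  -- Main claim: some sign state is `δ`-far from all vectors of stabilizer rank `≤ r`.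
  suffices hmain : ∃ s : QReg n → Bool, ∀ φ' : QReg n → ℂ,
      normSq (signVec s - φ') ≤ δ ^ 2 → ¬ stabilizerRank φ' ≤ r by
    obtain ⟨s, hs⟩ := hmain
    refine ⟨s, ?_⟩
    have hne : {k | ∃ φ : QReg n → ℂ, normSq (signVec s - φ) ≤ δ ^ 2 ∧ stabilizerRank φ = k}.Nonempty :=
      ⟨_, signVec s, by simp [normSq_eq_sum_norm_sq, sq_nonneg], rfl⟩
    obtain ⟨φ', hφ'1, hφ'2⟩ := Nat.sInf_mem hne
    have hge : r + 1 ≤ approxStabilizerRank δ (signVec s) := by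
      show r + 1 ≤ sInf {k | ∃ φ : QReg n → ℂ, normSq (signVec s - φ) ≤ δ ^ 2 ∧ stabilizerRank φ = k}
      rw [← hφ'2]
      exact Nat.lt_of_not_le (hs φ' hφ'1)
    calc 1 / 1000 * (1 - δ ^ 2) ^ 2 * (2 : ℝ) ^ n / (n : ℝ) ^ 2 = R₀ := by rw [hR₀]
      _ ≤ ⌈R₀⌉₊ := Nat.le_ceil _
      _ ≤ (r + 1 : ℕ) := by rw [hr]; exact_mod_cast (by omega : ⌈R₀⌉₊ ≤ ⌈R₀⌉₊ - 1 + 1)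
      _ ≤ approxStabilizerRank δ (signVec s) := by exact_mod_cast hge
  by_contra hall
  push Not at hall
  -- `hall : ∀ s, ∃ φ', normSq (signVec s - φ') ≤ δ ^ 2 ∧ stabilizerRank φ' ≤ r`
  rcases Nat.eq_zero_or_pos r with hr0 | hr1
  · -- rank `0` means `φ' = 0`, which is at distance `1 > δ` from a unit vector
    obtain ⟨φ', h1, h2⟩ := hall fun _ => false
    rw [hr0, Nat.le_zero] at h2
    obtain ⟨c, φ, _, hφ'⟩ := exists_decomp_of_stabilizerRank_le h2.le
    rw [Finset.univ_eq_empty, Finset.sum_empty] at hφ'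
    rw [hφ', sub_zero, normSq_eq_sum_norm_sq, sum_norm_sq_signVec] at h1
    nlinarith
  · -- the union bound
    set ε := g / 4 with hε
    have hε0 : 0 < ε := by positivity
    have hδε : δ + ε < 1 := by nlinarith
    -- every sign state is close to the span of some `r`-tuple of parameter vectors
    let BadP : (Fin r → Param n) → Finset (QReg n → Bool) := fun P =>
      Finset.univ.filter fun s => ∃ c : Fin r → ℂ, ∑ x, ‖signVec s x - (∑ i, c i • vec (P i)) x‖ ^ 2 ≤ δ ^ 2
    have hcover : (Finset.univ : Finset (QReg n → Bool)) ⊆ Finset.univ.biUnion BadP := by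
      intro s _
      obtain ⟨φ', h1, h2⟩ := hall s
      obtain ⟨P, c, hφ'⟩ := exists_param_comb_of_stabilizerRank_le h2
      rw [Finset.mem_biUnion]
      refine ⟨P, Finset.mem_univ _, Finset.mem_filter.2 ⟨Finset.mem_univ _, c, ?_⟩⟩
      rw [← hφ']
      simpa only [normSq_eq_sum_norm_sq, Pi.sub_apply] using h1
    have hbound : ∀ P : Fin r → Param n, ((BadP P).card : ℝ) ≤
        ((2 * (⌈4 * r / ε⌉₊ + 1) + 1 : ℕ) : ℝ) ^ (2 * r) *
          (2 ^ Fintype.card (QReg n) * Real.exp (-(Fintype.card (QReg n) * (1 - (δ + ε) ^ 2) / 2))) :=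
      fun P => card_signVec_close_span_le hr1 (fun i => vec (P i)) hδ0.le hε0 hδε
    have hcount : ((2 : ℝ) ^ (2 ^ n)) ≤ (2 ^ (3 * n ^ 2 + 3 * n) : ℝ) ^ r *
        (((2 * (⌈4 * r / ε⌉₊ + 1) + 1 : ℕ) : ℝ) ^ (2 * r) *
          (2 ^ (2 ^ n) * Real.exp (-((2 ^ n : ℝ) * (1 - (δ + ε) ^ 2) / 2)))) := by
      have h1 : (Fintype.card (QReg n → Bool) : ℝ) ≤ ∑ P : Fin r → Param n, ((BadP P).card : ℝ) := by
        have := (Finset.card_le_card hcover).trans Finset.card_biUnion_le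
        rw [Finset.card_univ] at this
        exact_mod_cast this
      rw [Fintype.card_fun, Fintype.card_bool, card_QReg] at h1
      push_cast at h1
      refine h1.trans ?_
      have h2 := Finset.sum_le_sum fun P (_ : P ∈ (Finset.univ : Finset (Fin r → Param n))) => hbound P
      refine h2.trans (le_of_eq ?_)
      rw [Finset.sum_const, Finset.card_univ, Fintype.card_fun, Fintype.card_fin, card_param, nsmul_eq_mul,
        card_QReg]
      push_cast
      ring
    -- but the right-hand side is `< 2^(2^n)`
    have hkey := key_inequality hδ0 hδ1 hn hr1 hrR
    have hlt : (2 ^ (3 * n ^ 2 + 3 * n) : ℝ) ^ r *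
        (((2 * (⌈4 * r / ε⌉₊ + 1) + 1 : ℕ) : ℝ) ^ (2 * r) *
          (2 ^ (2 ^ n) * Real.exp (-((2 ^ n : ℝ) * (1 - (δ + ε) ^ 2) / 2)))) < (2 : ℝ) ^ (2 ^ n) := by
      have hb : (0 : ℝ) < ((2 * (⌈4 * r / ε⌉₊ + 1) + 1 : ℕ) : ℝ) := by positivity
      rw [show (2 ^ (3 * n ^ 2 + 3 * n) : ℝ) ^ r = Real.exp (r * ((3 * n ^ 2 + 3 * n : ℕ) * Real.log 2)) by
          rw [← pow_mul, pow_eq_exp_mul_log two_pos]; push_cast; ring_nf,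
        show (((2 * (⌈4 * r / ε⌉₊ + 1) + 1 : ℕ) : ℝ)) ^ (2 * r) =
            Real.exp (2 * r * Real.log ((2 * (⌈4 * r / ε⌉₊ + 1) + 1 : ℕ) : ℝ)) by
          rw [pow_eq_exp_mul_log hb]; push_cast; ring_nf]
      have : Real.exp (r * ((3 * n ^ 2 + 3 * n : ℕ) * Real.log 2)) *
          (Real.exp (2 * r * Real.log ((2 * (⌈4 * r / ε⌉₊ + 1) + 1 : ℕ) : ℝ)) *
            (2 ^ (2 ^ n) * Real.exp (-((2 ^ n : ℝ) * (1 - (δ + ε) ^ 2) / 2)))) =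
          2 ^ (2 ^ n) * Real.exp (r * ((3 * n ^ 2 + 3 * n : ℕ) * Real.log 2) +
            2 * r * Real.log ((2 * (⌈4 * r / ε⌉₊ + 1) + 1 : ℕ) : ℝ) -
              (2 ^ n : ℝ) * (1 - (δ + ε) ^ 2) / 2) := by
        rw [Real.exp_sub, Real.exp_add, Real.exp_neg]
        ring
      rw [this]
      have hexp : Real.exp (r * ((3 * n ^ 2 + 3 * n : ℕ) * Real.log 2) +
            2 * r * Real.log ((2 * (⌈4 * r / ε⌉₊ + 1) + 1 : ℕ) : ℝ) -
              (2 ^ n : ℝ) * (1 - (δ + ε) ^ 2) / 2) < 1 :=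
        Real.exp_lt_one_iff.2 hkey
      have h2pos : (0 : ℝ) < 2 ^ (2 ^ n) := by positivity
      nlinarith
    exact absurd (hcount.trans_lt hlt) (lt_irrefl _)

end Literature.Computability.QuantumComplexity

end
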